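import Summits.BirchSwinnertonDyer.Rank1Residual.F1Sign2.CasselsTateSignAtTwo
import Literature.NumberTheory.EllipticCurves.UnramifiedPrimeTwist
import HarnessLib

/-!
# Cell `bsd-f1-sign2` — descent lens (planner `-desc`, g9; MEMO-desc §17): the Cassels–Tate form is AFFINE on a rigid twist family
(THEOREM A) and its odd-branch shadow, the RADICAL SUM LAW — typed over the tree's Mazur–Rubin twist formalism `PrimeTwist`

STATEMENTS + PROVED glue (support definitions WITH bodies `IsQuadraticCharacterOf`, `QuadraticCharacterExists`, `twistShaMapAtTwo`
(noncomputable), `InTwistCasselsTateRadicalAtTwo`, `TwistCasselsTateOddAtTwo`, `TwistRadicalLeavesAtTwo`; five typed candidates as plain `def … : Prop`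
exactly as the planner's sketch has them — DESC-§17-A `OddBranchCasselsTateRadicalSumLawAtTwo` (LEAD, theorem candidate = Theorem A(iii) on the odd
branch), DESC-§17-U′ `OddBranchShaIndexTwoInTwistSelmerAtTwo` (support), DESC-§17-A∞ `OddBranchCasselsTateRadicalRealParityLawAtTwo`, bridge DESC-§17-B⁰
`OddBranchEggBitEqRadicalBitAtTwo`, DESC-§17-B `OddBranchEggCasselsTateParityLawOfPosRankAtTwo` (= REF1 §35's repair DESC-P′ of the landed
`OddBranchEggCasselsTateParityLawAtTwo`); two glue theorems PROVED; nothing asserted, no named fact, no `sorry`).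

TYPER FILING (seat `bsd-f1-sign2-ty` g3; CANDIDATES.md rows DESC-§17-A / U′ / A∞ / B⁰ / B): bodies VERBATIM from the planner's
`HOME/MEMO-desc-data/g9/Sketch-v9.lean` 9e057b075e4ba9a3 (-desc g9 2026-08-27T23:13:57Z, MEMO-desc.md f0d2bd8f72725a4e §17 l.933–970; lean rc 0 / 0 err /
0 warn / 0 sorry per -desc; BC7 `g9/bc9.out` 178e4bf485df8244 4/4 CLEAN; census `g9/T-AFF9-v1.txt` cdceda7bcd738628 on g8's TABLE-MWALIGN8-v1 ef7eb38c134fd98d);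
the only edits are this header and the REMOVAL of the sketch's two self-containedness re-declarations `EggCasselsTateBitAtTwo` /
`OddBranchEggCasselsTateParityLawAtTwo`, which are tree declarations of the imported `F1Sign2/CasselsTateSignAtTwo.lean` since p582984 (same bodies;
the tree's DESC-P carries `@[conjecture]`). Port cut = the planner's first option (sibling file importing `CasselsTateSignAtTwo` +
`Literature/NumberTheory/EllipticCurves/UnramifiedPrimeTwist`). REF1-AUDIT-v1 §41 (9b6462d535fd58fa, 2026-08-27T23:43:23Z; D-desc-ref1-g9 ANSWERED; evidence `HOME/REF1-data/b38/`): sketch as-is rc 1 = the 2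
re-declarations (in the tree since p582984 with VERBATIM identical bodies ⇒ «-ty's cut is neutral»), dedup rc 0·0·0·0; probe rc 0, **BC7 6/6 CLEAN** (DESC-A, U′,
A∞, B⁰, THEOREM B, `QuadraticCharacterExists`); guards kernel-checked (G1 `d = 1 ⇒ χ = 1`, G2 `¬ Leaves ⊤`, G3 `DescAdmissible ⇒ ¬ IsSquare d` ⇒ no junk `χ`
on any typed row); **DESC-A `OddBranchCasselsTateRadicalSumLawAtTwo` SURVIVES, THEOREM-GRADE in-print assembly** — the SMod-object identification checked place by
place: `v ∣ 2N∞`: `d/d₃ = u²` in `ℚ_v`, `(x,y) ↦ (x,uy)` is the identity on `M` ⇒ identical Kummer conditions; admissible `q`: a fixed-point-free `Frob_q ∈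
GL₂(𝔽₂) ≅ S₃` is a 3-CYCLE, so in the INERT case `Frob_w = Frob_q²` is again fixed-point-free, `H⁰ = H² = 0`, `χ = 1` ⇒ `H¹(K_w, M) = 0` (ramified `w`: residue
degree 1, same); elsewhere unramified ⇒ the two Kramer sequences for `(d,d′)`, `(d₃,d₄)` with `dd′d₃d₄ ∈ ℚ^{×2}` are the SAME SMod sequence ⇒ MS24 §8.2 gives
`Σ CT_{dᵢ} = 0` ⇒ `Σ g_{dᵢ} = 0` via `Λ²R^∨ ≅ R`; U′ re-derived (loc_∞ of the ∞-relaxed Selmer group is a LAGRANGIAN line of `H¹(ℝ, M) = M`, so `#S = 4 < #R = 8`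
forces `S = U₀ ⊂ R = U` of index 2) and B⁰ THEOREM-GRADE (θ = − ∧ rank ≥ 1 ∧ `#R = 8` ∧ no 2-torsion ⇒ rank = 1, radical on `R` = the MW line `⟨δP⟩`,
Leaves `S` ⟺ `(δP)_∞ ≠ 0` ⟺ `P ∉ E^{(d)}(ℝ)⁰` ⟺ `MeetsEgg`) MODULO the one untyped load-bearing item, the MODEL ↔ `PrimeTwist` DICTIONARY
(`(W.quadraticTwist d).selmerGroup 2` / Ш ≅ `PrimeTwist.selmerGroup / sha W χ_d`, Mazur–Rubin 2007 §3 / MRS for `p = 2`; the tree's `PrimeTwist` objects accept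
ramified `χ`, `𝔓 = (σ−1) = (2)`, `χ = 1 ↦ E` itself — no junk) used by U′ and B⁰ — REF1's non-blocking RECOMMENDATION to -desc: one explicit support row
`TwistModelDictionaryAtTwo` (an `AddEquiv`, or the two consequences used); `IsQuadraticCharacterOf` (∀-root form pins `χ` for non-square `d`),
`twistShaMapAtTwo` (plain kernel-checked data, fine in a statement file), `InTwistCasselsTateRadicalAtTwo` (= Cassels' kernel `2Ш[4]` = MS21 1.3(1)), the
4× (`H ≤ Sel χᵢ` ∧ `relIndex = 2`) and the iff-nesting all ✓; A∞, THEOREM B: glue PROVED; DESC-P (landed) unchanged = THEOREM B minus «θ = − ⇒ rank ≥ 1»;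
mutation: `IsSquare`, `a_q` odd, `#R = 8` each load-bearing. «-ty: port v9 minus the duplicates as drafted» — done here. REF2-PLACEMENT v16 §24 (3fd65b9e2dca2769, 2026-08-27T23:16:22Z; D-ref2-desc-g9 ANSWERED;
texts read Morgan 2023 arXiv:2309.02374, Harpaz 2019 arXiv:1703.04992 = PLMS 118, Morgan–Smith 2024 arXiv:2206.13403 §8.2): **(a) (G) / DESC-§17-A =
VARIANT of Morgan 2023, in-print assembly, corollary-grade** (REF2 concurs with the planner). Printed lever, hypotheses VERBATIM (Morgan 2023, held
`paper:arxiv-2309.02374`): Lemma 16 [p0009 L33–43] «Let `Σ` be a finite set of places of `K` containing all places dividing `2N_A∞`. Suppose that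
`χ : G_K → μ₂` is a quadratic character such that: • `res_v(χ)` is trivial for all `v ∈ Σ`, • if `χ` is ramified at a place `v ∉ Σ`, then
`A[2]^{Frob_v} = 0`. Then `Sel²(A^χ/K) = Sel²(A/K)` as subgroups of `H¹(K, A[2])`. Moreover … `rk₂(A^χ/K) ≡ rk₂(A/K) (mod 2)`» (= the cell's rigid
admissible family); **Prop 19** [p0010 L39–47] «Let `Σ` be a finite set of places of `K` containing all places dividing `2N_A∞`, and such that `γ_{a,b}`
is unramified outside `Σ`. Suppose that `χ : G_K → μ₂` is a quadratic character such that `res_v(χ)` is trivial for all `v ∈ Σ`, and such that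
`A[2]^{Frob_v} = 0` for all places `v ∈ Ram(χ)∖Σ`. Then `𝔞` and `𝔟` lie in `Sel²(A^χ/K)`, and we have
`CTP(𝔞,𝔟) + CTP_χ(𝔞,𝔟) = Σ_{v ∈ Ram(χ)∖Σ} ψ_{a,b}(Frob_v)`» (proof via the MS21/MS24 sequence `[A[2] → R_{F/K}A[2] → A[2]]` = the planner's
(pb_kramer) naturality [2206.13403 p0021 L40–53; Thm 8.4 = Kramer Thm 2]; Rem 21 cocycle proof; Rem 22 `ψ` = Frobenius in the `V_a` field); Thm 12
[p0006 L18–32] (every admissible pairing occurs ⇒ DESC-E qualitative); full-2-torsion precedents Harpaz 2019 Prop 3.24 [1703.04992 p0018 L23–30],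
Smith 2016 Thm 3.2. THE DELTA (the planner's, confirmed «real but small and correctly stated»; marked here as OURS): all printed comparisons take
`χ` trivial on ALL of `Σ ∋ ∞` (Harpaz: «a square over `S∖M`», `S` ∋ archimedean places); two odd-branch admissible twists differ by `χ_{dd′}` ramified at
`ℓ ∣ dd′` where the base twist is bad, so Prop 19 as printed does not apply; the relaxation «`χ_v` trivial OR `H¹(K_v, A[2]) = 0`» runs through the same
proof — five lines, not a mechanism. REF2's import advice: the STRONGER printed shape `g_d − g_{d′} = Σ_{ℓ ∣ dd′} ψ(Frob_ℓ)` (explicit linear part) subsumes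
DESC-§17-A (sums cancel in pairs on square quadruples) and gives DESC-E its Chebotarev handle. **(b) DESC-P′ = DESC-§17-B: mechanism IN PRINT** (Morgan
2023 §1.2 [p0006 L1–5] = HS16 step (3) = MEMO-desc §16 (K): unique `Sel⁴`-lift + odd `rk₂` + Ш finite ⇒ `𝔞 ∈ δ(A^χ(K))`), **REAL-COMPONENT READING NOT IN
PRINT** (`res_∞` of that line never appears: `Σ ∋ ∞` with `χ` trivial there in Morgan / Harpaz / HS16 / MS21 / MS24 / Smith) ⇒ new-combination (small);
v16 §19 currency «beyond-print theorem (small) by in-print assembly» STANDS, nearest print now Morgan 2023 Prop 19 / §1.2; A∞ / B⁰ / U′ inherit;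
refuted in print: nothing (Thm 12 consistent with T-AFF9 0 violations). Bib keys added at this filing: `Morgan2023KummerGeneric`, `Harpaz2019SecondDescent`,
`MorganSmith2024FieldChange` (with `MorganSmith2021CTP` from T-desc-8).
PARTITION: none moved; beyond-print theorem: per REF2 v16 §19 YES-small for (G) / DESC-Θ / DESC-P′ pending write-up (the planner notes §17's nearer
prints — Morgan 2023 Prop 19, Harpaz 2019 Prop 3.24, Morgan–Smith 2024 §8.2 / Thm 8.4 — may revise (G) to in-print-assembly; REF2's call).
bears_on: `stmt-BirchSwinnertonDyer-19099` `RankOneAtTwo` (via DESC-N; THEOREM B's only L-contact is «analytic rank 1 of the θ = − twists»).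

LANDING NOTE (-ty g14, 2026-08-29T00:5xZ; text only, statements untouched): **U′ `OddBranchShaIndexTwoInTwistSelmerAtTwo` IS NOW A TREE THEOREM,
unconditionally** — `Summit.BirchSwinnertonDyer.BirchSwinnertonDyer.Theorems.GenusKolyArch.oddBranchShaIndexTwoInTwistSelmerAtTwo_holds :
OddBranchShaIndexTwoInTwistSelmerAtTwo` (gk2-p5 g15, p681228 ACCEPTED, file
`Summits/BirchSwinnertonDyer/BirchSwinnertonDyer/Theorems/GenusKolyvaginAtTwoGenusPrimitiveSupplyAtTwoPrimeTwistModelSelmer.lean` §179, std axioms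
`propext` / `Classical.choice` / `Quot.sound` — re-checked by the typer with `lean check --axioms`): on the odd branch `#Sel_𝔓(A_χ) = #Sel₂(W^{(d)}) = 8` by the
MODEL ↔ `PrimeTwist` DICTIONARY — REF1 §41's «one untyped load-bearing item» is DISCHARGED: `…GenusKolyArch.twistModelDictionaryAtTwo_holds :
F1Sign2.TwistModelDictionaryAtTwo` (all three clauses, same file §181; landing note in `F1Sign2/TwistSelmerRelaxedAtInfinityAtTwo.lean`) with the count
`natCard_primeTwist_selmerGroup_eq_twistSelmerTwoCard` — and `8 = 2·#Sel₂(W)`, so `Sel_𝔓(A_χ) = Sel₂^{rel ∞}(W)` (DESC-§17-R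
`…GenusKolyArch.twistSelmerEqRelaxedAtInfinityAtTwo_holds`, p673146) of index `8/4 = 2` over `Sel₂(W)` (`F1Sign2.shaIndexTwo_of_relaxed`)
[cite: MazurRubin2010, Lemma 3.2 and Prop 3.3] [cite: MazurRubin2007, §3 and Def 4.3] [cite: Kramer1981, Thm. 1]. Consumers: feed
`(hU : OddBranchShaIndexTwoInTwistSelmerAtTwo)` with `oddBranchShaIndexTwoInTwistSelmerAtTwo_holds`. CONSEQUENCES already kernel: **DESC-A∞ now follows from
DESC-A ALONE** — `…GenusKolyArch.oddBranchCasselsTateRadicalRealParityLawAtTwo_of_sumLaw : OddBranchCasselsTateRadicalSumLawAtTwo →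
OddBranchCasselsTateRadicalRealParityLawAtTwo` (this file's glue `radicalRealParityLaw_of_sumLaw` with `hU` discharged, p681228); `QuadraticCharacterExists` is a tree
theorem (`…Theorems.GenusKolyTransp.quadraticCharacterExists_holds`, gk2 p678637), so by this file's `eggParityLawOfPosRank_of_radicalLaw` THEOREM B
`OddBranchEggCasselsTateParityLawOfPosRankAtTwo` ⟸ DESC-A ∧ B⁰ with nothing else open. Off the odd branch the U′-shape «`Sel₂(W) ≤ Sel_𝔓(A_χ)` of index `2`»
holds IFF the Selmer egg bit is `0`, otherwise the roles swap (gk2-p5 g15, p681533 / p681961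
`…/Theorems/GenusKolyvaginAtTwoGenusPrimitiveSupplyAtTwoPrimeTwistRigidity.lean`: `selmerGroup_le_and_relIndex_eq_two_iff_forall_localization_eq_zero`,
`primeTwist_selmerGroup_le_and_relIndex_eq_two_of_exists_localization_ne_zero`; THEOREM A(i) rigidity `primeTwist_selmerGroup_eq_of_descAdmissible`).
STILL OPEN AS TYPED (plain `def`s without `_holds`): DESC-A `OddBranchCasselsTateRadicalSumLawAtTwo` (Morgan 2023 Prop 19 / Morgan–Smith trilinearity — not in
the tree), B⁰ `OddBranchEggBitEqRadicalBitAtTwo` (gk2-p5 g15 plan, HOME/HANDOFF «gk2-p5 g15 — FINAL»: clause (3) = the dictionary's θ-bit, DONE; (K) odd form ∧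
rank `1` ⇒ radical = the Mordell–Weil line, elementary from the LEAD's Cassels–Tate tree theorems — alternating + kernel = divisibles + `#Ш[2] = 4` force
`Ш(W^{(d)})[2^∞] = Ш[2]` when `θ = −`; (V) the real Kummer bit = the g10 real-egg bricks on `W^{(d)}` + one localization transport along `ψ` — not claimed
by any seat at this filing), hence THEOREM B. REF2 (gk2-p5 g15 placement line 00:16:30Z; v16 §24 above unchanged): KNOWN in print (Mazur–Rubin 2010 §3 /
Kramer 1981; Mazur–Rubin 2007 §3 + Prop 4.1 + Def 4.3; Silverman X.5.4, X.4.2(a)); kernel-new; beyond-print theorem: no. PARTITION: none; BSD not proved;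
no item closed; CANDIDATES.md row DESC-§17-U′ marked «TREE THEOREM».

LANDING NOTE 2 (-ty g14, 2026-08-29T02:2xZ; text only, statements untouched): **B⁰ `OddBranchEggBitEqRadicalBitAtTwo` IS NOW A TREE THEOREM, unconditionally** —
`Summit.BirchSwinnertonDyer.BirchSwinnertonDyer.Theorems.GenusKolyArch.oddBranchEggBitEqRadicalBitAtTwo_holds : OddBranchEggBitEqRadicalBitAtTwo` (gk2-p5 g16,
p686538 ACCEPTED, commit e9e1fe7a2b3d, file `Summits/BirchSwinnertonDyer/BirchSwinnertonDyer/Theorems/GenusKolyvaginAtTwoGenusPrimitiveSupplyAtTwoPrimeTwistEggBit.lean`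
§189; std axioms `propext` / `Classical.choice` / `Quot.sound` re-checked by the typer with `lean check --axioms`): §188 `eggBit_iff_twistRadicalLeaves_of_model` at
`C = 1` — for ANY model `V = C • W^{(d)}` with «`θ(V) = −` ⟹ rank `≥ 1`»: `(¬ ShaTwoInTwiceShaFour V ∧ MeetsEgg V) ↔ TwistRadicalLeavesAtTwo W χ Sel₂(W)` ((⇒) `κ`(egg point)
lies in the radical and outside `S = {loc_∞ = 0}`; (⇐) the KERNEL LEMMA (K) §191 `mordellWeilRank_eq_one_of_not_shaTwoInTwiceShaFour_of_model`: `θ(V) = −` ∧ rank `≥ 1` ⟹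
rank `V(ℚ) = 1` ∧ `#Ш(V)[2] = 4` ∧ `Ш(V)[2^∞] = Ш(V)[2]`, with §190 `natCard_sha_two_eq_four_and_exponent_two_of_natCard_le_four` over every number field).  Hence **THEOREM B
`OddBranchEggCasselsTateParityLawOfPosRankAtTwo` NOW FOLLOWS FROM DESC-A ALONE**: `…GenusKolyArch.oddBranchEggCasselsTateParityLawOfPosRankAtTwo_of_sumLaw :
OddBranchCasselsTateRadicalSumLawAtTwo → OddBranchEggCasselsTateParityLawOfPosRankAtTwo` (same file §189, std axioms re-checked; = this file's glue
`eggParityLawOfPosRank_of_radicalLaw` fed with A∞ ⟸ DESC-A `oddBranchCasselsTateRadicalRealParityLawAtTwo_of_sumLaw`, B⁰ `oddBranchEggBitEqRadicalBitAtTwo_holds` and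
`GenusKolyTransp.quadraticCharacterExists_holds`).  The rank clause of B⁰ is moreover DISCHARGED BY FINITENESS (gk2-p5 g16, p687196 ACCEPTED,
`Summits/BirchSwinnertonDyer/BirchSwinnertonDyer/Theorems/GenusKolyvaginAtTwoGenusPrimitiveSupplyAtTwoPrimeTwistEggBitFiniteSha.lean`:
`mordellWeilRank_eq_one_of_finite_sha_of_not_shaTwoInTwiceShaFour_of_model` — `Finite Ш(V)[2^∞]` ∧ `θ(V) = −` ⟹ rank `V = 1` —, `eggBit_iff_twistRadicalLeaves_of_model_of_finite`,
`oddBranchEggBitEqRadicalBit_of_finite_sha`; std axioms re-checked).  Consumers: feed `(hB : OddBranchEggBitEqRadicalBitAtTwo)` with `oddBranchEggBitEqRadicalBitAtTwo_holds`.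
STILL OPEN AS TYPED in this file: DESC-A `OddBranchCasselsTateRadicalSumLawAtTwo` ONLY (Morgan 2023 Prop 19 / Morgan–Smith trilinearity — not in the tree); every other row
here is a tree theorem (U′, B⁰) or follows from DESC-A by tree theorems (A∞, THEOREM B).  Known ingredients in print [cite: Cassels1962ArithmeticIV, §1] [cite: Kramer1981, Prop. 6]
[cite: MazurRubin2007, §3, Prop 4.1 and Def 4.3] [cite: MorganSmith2021CTP, Thm 1.3]; the bridge is the cell's bookkeeping (gk2-p5: kernel-new; beyond-print theorem: no).
PARTITION: none; BSD not proved; no item closed; CANDIDATES.md row DESC-§17-B⁰ marked «TREE THEOREM», THEOREM B marked «⟸ DESC-A alone (tree)».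

Planner's module docstring (verbatim):

THEOREM A (memo §17.1; informal proof complete, audit pending). Let `W/ℚ` be an elliptic curve and `𝒟` a RIGID ADMISSIBLE FAMILY of
square-free integers: (R1) `d/d' ∈ ℚ_v^{×2}` for all `d, d' ∈ 𝒟` and every `v ∈ {2, ∞} ∪ {ℓ ∣ N_W}`; (R2) every prime `q ∤ 2N_W`
dividing some `d ∈ 𝒟` has `a_q(W)` odd (equivalently `H¹(ℚ_q, W[2]) = 0`). Then, inside `H¹(ℚ, W[2])`:
(i) `R := Sel₂(W^{(d)})` does not depend on `d ∈ 𝒟`; (ii) for `d, d' ∈ 𝒟` the sum `CT_d + CT_{d'}` of the Cassels–Tate forms on `R`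
depends only on the square class of `dd'` — indeed `CT_d + CT_{d'} = CTP_{X(χ_{dd'})}` for an explicit self-extension `X(χ)` of
`(W[2], 𝒲)` in Morgan–Smith's category `SMod_ℚ`; (iii) hence `Σᵢ CT_{dᵢ} = 0` whenever `d₁ ⋯ d₂ₖ ∈ ℚ^{×2}`, `dᵢ ∈ 𝒟`.
Ingredients in print: [MS21 = Morgan–Smith arXiv:2103.08530: Thm 1.3 (pairing `CTP_E`, kernels, naturality) p.4; Example 1.4
(`E = [A[n] → A[mn] → A[m]]` recovers the classical pairing on `Sel_m × Sel_n`) p.4; Def 4.1 + Prop 4.2 (pullback/pushout local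
conditions) p.12; Def 4.3 + Prop 4.4 (Baer sum, TRILINEARITY `CTP_{E_a+E_b} = CTP_{E_a} + CTP_{E_b}`) p.13]. New step (the audit
point of REF2 v16 §16): an explicit isomorphism `Φ : E_d + E_{d'} ⥲ X(χ_{dd'})`, `(x, x') ↦ (x − x', 2x)`, of exact sequences in
`SMod_ℚ`, whose local component at `v ∣ 2N∞` carries the Baer-sum condition onto the SPLIT condition `𝒲_v ⊕ 𝒲_v` (computation in
§17.1), at `q ∣ dd'` everything vanishes (`H¹(ℚ_q, ·) = 0` for extensions of `W[2]` by `W[2]`), elsewhere unramified.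
The tree's `DescAdmissible W d` (`d < 0`, `d ≡ 1 (8)`, `q ∣ d ⇒` good with `a_q` odd, `(d/ℓ) = 1` at odd bad `ℓ`) places `d` in ONE
rigid family (trivial classes at every `v ∣ 2N`, negative at `∞`).

ODD-BRANCH SHADOW (typed below). On `OnOddBranchAtTwo W` one has `dim R = 3`, `CT_d` alternating (Cassels), so `CT_d = det(g_d, ·, ·)`
for a unique `g_d ∈ R` (`Λ²R^∨ ≅ R` canonically over `𝔽₂`): `g_d = 0` iff `CT_d ≡ 0` iff `Ш(W^{(d)})[2] ⊆ 2Ш(W^{(d)})[4]` (`θ = +`),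
else `⟨g_d⟩ =` the radical of `CT_d = {x ∈ R : x̄ ∈ 2·Ш(W^{(d)})[4]}` [MS21 Thm 1.3: left kernel `= π(Sel₄)`]. Theorem A(iii) reads
`Σ g_{dᵢ} = 0`, i.e. FOR EVERY INDEX-2 SUBGROUP `H ≤ R` THE NUMBER OF `i` WITH `g_{dᵢ} ∉ H` IS EVEN — a statement about Selmer
groups and `Ш[4]` only (no pairing object needed), typed as `OddBranchCasselsTateRadicalSumLawAtTwo` over the tree's twist
formalism `PrimeTwist` (Mazur–Rubin 2007: for `p = 2` and `χ` the character of `ℚ(√d)/ℚ`, `A_χ = W^{(d)}`, and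
`PrimeTwist.selmerGroup W χ = Sel₂(W^{(d)}) ⊆ H¹(ℚ, W[2]) = W.galH1Torsion 2`, `PrimeTwist.sha W χ = Ш(W^{(d)}/ℚ)`).
The instance `H = S := Sel₂(W) = Ш(W)[2] = {x ∈ R : res_∞ x = 0}` is DESC-P's Selmer avatar (`OddBranchCasselsTateRadicalRealParityLawAtTwo`):
for `θ(d) = −` and `rank W^{(d)} ≥ 1` the radical line is the Mordell–Weil line and «`g_d ∉ S`» = «the generator meets the egg».

CENSUS = BC5 (HOME/MEMO-desc-data/g9/T-AFF9-v1.txt on g8's TABLE-MWALIGN8-v1.tsv ef7eb38c134fd98d; 89 odd-branch classes, 3 670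
twists, two engines as in §16): T-H (the typed law, all 7 index-2 subgroups `H`) 8 316/8 316; T-AFF (FULL affinity = every even
square relation, strictly stronger than quadruples) 89/89 classes, 257 independent relations, 0 violations — of which 138 relate
`d ≡ 1` to `d ≡ 5 (mod 8)` twists (Theorem A with the family `{1, 5}·ℚ₂^{×2}` merged, legitimate iff the unramified norm index
`i₂ = 0`: good reduction at 2 [Mazur 1972] 37 + 73 relations, additive 28); pattern split of the quadruple law 1111: 258/258,
1155: 852/852, 5555: 78/78.
-/

open scoped Classical

open WeierstrassCurve Literature.NumberTheory.EllipticCurves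

namespace Summit.BirchSwinnertonDyer.Rank1Residual.F1Sign2

/-- `χ` is the quadratic character of `ℚ(√d)/ℚ`: `χ σ` is trivial iff `σ` fixes the square roots of `d` in `ℚ̄`
(for `d ∈ ℚ^{×2}` this says `χ = 1`). Existence and uniqueness of `χ` for every `d` is Kummer theory (support row
`quadraticCharacter_exists`). -/
def IsQuadraticCharacterOf (χ : Field.absoluteGaloisGroup ℚ →ₜ* Multiplicative (ZMod 2)) (d : ℤ) : Prop :=
  ∀ r : AlgebraicClosure ℚ, r ^ 2 = ((d : ℚ) : AlgebraicClosure ℚ) →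
    ∀ σ : Field.absoluteGaloisGroup ℚ, χ σ = 1 ↔ (@id (AlgebraicClosure ℚ ≃ₐ[ℚ] AlgebraicClosure ℚ) σ) r = r

/-- SUPPORT (Kummer theory; routine): every `d` has a quadratic character. Non-vacuity of the laws below. -/
def QuadraticCharacterExists : Prop :=
  ∀ d : ℤ, ∃ χ : Field.absoluteGaloisGroup ℚ →ₜ* Multiplicative (ZMod 2), IsQuadraticCharacterOf χ d

/-- The map `H¹(ℚ, W[2]) → H¹(ℚ, A_χ)` induced by `W[2] = A_χ[𝔓] ⊆ A_χ(ℚ̄)` (the tree's `PrimeTwist.constEmb`, MR Prop. 4.1 /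
Remark 4.2), i.e. `H¹(ℚ, W^{(d)}[2]) → H¹(ℚ, W^{(d)})`; its kernel is the Mordell–Weil (Kummer) image `W^{(d)}(ℚ)/2` and it carries
`Sel₂(W^{(d)})` onto `Ш(W^{(d)})[2]`. -/
noncomputable def twistShaMapAtTwo (W : WeierstrassCurve ℚ)
    (χ : Field.absoluteGaloisGroup ℚ →ₜ* Multiplicative (ZMod 2)) :
    W.galH1Torsion ((2 : ℕ) : ℤ) →+ PrimeTwist.galH1 W χ :=
  (ContinuousCohomology.map (ContinuousMonoidHom.id (Field.absoluteGaloisGroup ℚ))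
    (resHomOfEquivariant (ContinuousMonoidHom.id (Field.absoluteGaloisGroup ℚ))
      (PrimeTwist.constEmb (χ : Field.absoluteGaloisGroup ℚ →* Multiplicative (ZMod 2)) W.geomPoints)
      (fun _ _ ↦ rfl)) 1).hom.toLinearMap.toAddMonoidHom

/-- `x ∈ Sel₂(W^χ)` lies in the RADICAL of the Cassels–Tate form of the twist: its image in `Ш(W^χ)` is twice a `4`-torsion class of
`Ш(W^χ)` (equivalently `x ∈ 2·Sel₄(W^χ)`; [MS21 Thm 1.3]: this is the left kernel of `CT` on `Sel₂`). -/
def InTwistCasselsTateRadicalAtTwo (W : WeierstrassCurve ℚ)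
    (χ : Field.absoluteGaloisGroup ℚ →ₜ* Multiplicative (ZMod 2)) (x : W.galH1Torsion ((2 : ℕ) : ℤ)) : Prop :=
  x ∈ PrimeTwist.selmerGroup W χ ∧
    ∃ c ∈ PrimeTwist.sha W χ, (4 : ℕ) • c = 0 ∧ (2 : ℕ) • c = twistShaMapAtTwo W χ x

/-- `θ(W^χ) = −`: the Cassels–Tate form of the twist is NOT identically zero on `Sel₂(W^χ)` (some Selmer class is outside the radical;
same content as `¬ ShaTwoInTwiceShaFour` of the twisted model, in the `PrimeTwist` formalism). -/
def TwistCasselsTateOddAtTwo (W : WeierstrassCurve ℚ)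
    (χ : Field.absoluteGaloisGroup ℚ →ₜ* Multiplicative (ZMod 2)) : Prop :=
  ∃ x ∈ PrimeTwist.selmerGroup W χ, ¬ InTwistCasselsTateRadicalAtTwo W χ x

/-- «`g_χ ∉ H`»: the form is odd AND its radical is not contained in `H` (on the odd branch the radical of an odd form is a LINE
`⟨g_χ⟩`, so this says exactly that the governing vector `g_χ` lies outside `H`; for an even form `g_χ = 0 ∈ H`). -/
def TwistRadicalLeavesAtTwo (W : WeierstrassCurve ℚ)
    (χ : Field.absoluteGaloisGroup ℚ →ₜ* Multiplicative (ZMod 2)) (H : AddSubgroup (W.galH1Torsion ((2 : ℕ) : ℤ))) : Prop :=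
  TwistCasselsTateOddAtTwo W χ ∧ ∃ x, InTwistCasselsTateRadicalAtTwo W χ x ∧ x ∉ H

/-- **DESC-A `OddBranchCasselsTateRadicalSumLawAtTwo` (LEAD; THEOREM CANDIDATE = Theorem A(iii) on the odd branch, memo §17).**
On the odd branch, for admissible `d₁ … d₄` with quadratic characters `χᵢ` and `d₁d₂d₃d₄ ∈ ℚ^{×2}`, and for every subgroup `H` of
index `2` in the common Selmer group `R = Sel₂(W^{(dᵢ)})`, the number of `i` whose Cassels–Tate radical line leaves `H` is EVEN
(`⟺ Σᵢ g_{dᵢ} = 0` in `R ≅ 𝔽₂³ ⟺ Σᵢ CT_{dᵢ} = 0`). BC5: T-H 8 316/8 316 (7 subgroups × 1 188 admissible square quadruples, 89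
classes; kernel engine Fisher-2022 Gram + PARI points), T-AFF 257/257 independent even relations. Why it might fail: only through
an error in the local clause of §17.1 at `v = 2` for additive `W` (data: 386/386 quadruples on 18 additive classes).
REF2-PLACEMENT v16 §24: VARIANT of Morgan 2023 Prop 19 (in-print assembly, corollary-grade): the printed comparison
`CTP + CTP_χ = Σ_{v ∈ Ram(χ)∖Σ} ψ_{a,b}(Frob_v)` needs «`res_v(χ)` trivial for all `v ∈ Σ ⊇ {v ∣ 2N_A∞}`» — OUR relaxation «`χ_v` trivial OR
`H¹(K_v, A[2]) = 0` at `v ∈ Σ`» (admissible twists of different support) runs through the same proof. REF1-AUDIT §41: SURVIVES, THEOREM-GRADE in-print assembly (BC7 CLEAN; SMod-object identification checked at all three place types incl. inert admissible `q`).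
[cite: Morgan2023KummerGeneric, Lemma 16, Prop 19, Thm 12] [cite: MorganSmith2021CTP, Thm 1.3, Prop 4.4] [cite: MorganSmith2024FieldChange, §8.2, Thm 8.4]
[cite: Harpaz2019SecondDescent, Prop 3.24] [cite: Kramer1981, Thm 2] -/
def OddBranchCasselsTateRadicalSumLawAtTwo : Prop :=
  ∀ (W : WeierstrassCurve ℚ) [W.IsElliptic] [W.IsGloballyMinimal], OnOddBranchAtTwo W →
    ∀ (d₁ d₂ d₃ d₄ : ℤ) (χ₁ χ₂ χ₃ χ₄ : Field.absoluteGaloisGroup ℚ →ₜ* Multiplicative (ZMod 2)),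
      DescAdmissible W d₁ → DescAdmissible W d₂ → DescAdmissible W d₃ → DescAdmissible W d₄ →
      IsQuadraticCharacterOf χ₁ d₁ → IsQuadraticCharacterOf χ₂ d₂ →
      IsQuadraticCharacterOf χ₃ d₃ → IsQuadraticCharacterOf χ₄ d₄ →
      IsSquare (d₁ * d₂ * d₃ * d₄) →
        ∀ H : AddSubgroup (W.galH1Torsion ((2 : ℕ) : ℤ)),
          H ≤ PrimeTwist.selmerGroup W χ₁ → H.relIndex (PrimeTwist.selmerGroup W χ₁) = 2 →
          H ≤ PrimeTwist.selmerGroup W χ₂ → H.relIndex (PrimeTwist.selmerGroup W χ₂) = 2 →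
          H ≤ PrimeTwist.selmerGroup W χ₃ → H.relIndex (PrimeTwist.selmerGroup W χ₃) = 2 →
          H ≤ PrimeTwist.selmerGroup W χ₄ → H.relIndex (PrimeTwist.selmerGroup W χ₄) = 2 →
            ((TwistRadicalLeavesAtTwo W χ₁ H ↔ TwistRadicalLeavesAtTwo W χ₂ H) ↔
              (TwistRadicalLeavesAtTwo W χ₃ H ↔ TwistRadicalLeavesAtTwo W χ₄ H))

/-- SUPPORT (U): on the odd branch `S := Sel₂(W) = Ш(W)[2]` is an index-`2` subgroup of `Sel₂(W^{(d)})` for every admissible `d`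
(both inside `H¹(ℚ, W[2])`; memo §16.1 (U) / §17.1 (i): identical finite local conditions, `S` = the classes of `R` trivial at `∞`). -/
def OddBranchShaIndexTwoInTwistSelmerAtTwo : Prop :=
  ∀ (W : WeierstrassCurve ℚ) [W.IsElliptic] [W.IsGloballyMinimal], OnOddBranchAtTwo W →
    ∀ (d : ℤ) (χ : Field.absoluteGaloisGroup ℚ →ₜ* Multiplicative (ZMod 2)),
      DescAdmissible W d → IsQuadraticCharacterOf χ d →
        W.selmerGroup ((2 : ℕ) : ℤ) ≤ PrimeTwist.selmerGroup W χ ∧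
          (W.selmerGroup ((2 : ℕ) : ℤ)).relIndex (PrimeTwist.selmerGroup W χ) = 2

/-- **DESC-A∞ `OddBranchCasselsTateRadicalRealParityLawAtTwo` (THEOREM CANDIDATE; the instance `H = S = Sel₂(W) = Ш(W)[2]` of DESC-A,
= the Selmer avatar of DESC-P).** On an admissible square quadruple the number of `i` with «`θ(dᵢ) = −` and the Cassels–Tate radical
of `W^{(dᵢ)}` not inside `Ш(W)[2]`» (i.e. not locally trivial at `∞`) is EVEN. BC5: T-P 1 188/1 188 (pattern `d mod 8`: 1111
258/258, 1155 852/852, 5555 78/78). -/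
def OddBranchCasselsTateRadicalRealParityLawAtTwo : Prop :=
  ∀ (W : WeierstrassCurve ℚ) [W.IsElliptic] [W.IsGloballyMinimal], OnOddBranchAtTwo W →
    ∀ (d₁ d₂ d₃ d₄ : ℤ) (χ₁ χ₂ χ₃ χ₄ : Field.absoluteGaloisGroup ℚ →ₜ* Multiplicative (ZMod 2)),
      DescAdmissible W d₁ → DescAdmissible W d₂ → DescAdmissible W d₃ → DescAdmissible W d₄ →
      IsQuadraticCharacterOf χ₁ d₁ → IsQuadraticCharacterOf χ₂ d₂ →
      IsQuadraticCharacterOf χ₃ d₃ → IsQuadraticCharacterOf χ₄ d₄ →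
      IsSquare (d₁ * d₂ * d₃ * d₄) →
        ((TwistRadicalLeavesAtTwo W χ₁ (W.selmerGroup ((2 : ℕ) : ℤ)) ↔ TwistRadicalLeavesAtTwo W χ₂ (W.selmerGroup ((2 : ℕ) : ℤ))) ↔
          (TwistRadicalLeavesAtTwo W χ₃ (W.selmerGroup ((2 : ℕ) : ℤ)) ↔ TwistRadicalLeavesAtTwo W χ₄ (W.selmerGroup ((2 : ℕ) : ℤ))))

/-- Proved glue: DESC-A + (U) ⇒ DESC-A∞. -/
theorem radicalRealParityLaw_of_sumLaw (hA : OddBranchCasselsTateRadicalSumLawAtTwo)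
    (hU : OddBranchShaIndexTwoInTwistSelmerAtTwo) : OddBranchCasselsTateRadicalRealParityLawAtTwo := by
  intro W _ _ hW d₁ d₂ d₃ d₄ χ₁ χ₂ χ₃ χ₄ h₁ h₂ h₃ h₄ c₁ c₂ c₃ c₄ hsq
  exact hA W hW d₁ d₂ d₃ d₄ χ₁ χ₂ χ₃ χ₄ h₁ h₂ h₃ h₄ c₁ c₂ c₃ c₄ hsq _
    (hU W hW d₁ χ₁ h₁ c₁).1 (hU W hW d₁ χ₁ h₁ c₁).2 (hU W hW d₂ χ₂ h₂ c₂).1 (hU W hW d₂ χ₂ h₂ c₂).2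
    (hU W hW d₃ χ₃ h₃ c₃).1 (hU W hW d₃ χ₃ h₃ c₃).2 (hU W hW d₄ χ₄ h₄ c₄).1 (hU W hW d₄ χ₄ h₄ c₄).2

/-- SUPPORT / BRIDGE (K)+(V) between the two formalisms: for an admissible twist whose rank is positive when its form is odd, the egg bit
of the model `W^{(d)}` equals the radical-leaves-`S` bit of `A_{χ_d}` (kernel lemma: odd form ⇒ radical = Mordell–Weil line given rank `≥ 1`;
real-component lemma: the line lies in `S` iff the generator is on the identity component). Needs the tree-internal identifications
`Sel₂ / Ш` of `W.quadraticTwist d` with `PrimeTwist.selmerGroup / sha W χ_d` (Mazur–Rubin 2007 §3: `A_χ = W^{(d)}`). -/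
def OddBranchEggBitEqRadicalBitAtTwo : Prop :=
  ∀ (W : WeierstrassCurve ℚ) [W.IsElliptic] [W.IsGloballyMinimal], OnOddBranchAtTwo W →
    ∀ (d : ℤ) (χ : Field.absoluteGaloisGroup ℚ →ₜ* Multiplicative (ZMod 2)),
      DescAdmissible W d → IsQuadraticCharacterOf χ d →
      (¬ ShaTwoInTwiceShaFour (W.quadraticTwist (d : ℚ)) → 0 < (W.quadraticTwist (d : ℚ)).mordellWeilRank) →
        (EggCasselsTateBitAtTwo W d ↔ TwistRadicalLeavesAtTwo W χ (W.selmerGroup ((2 : ℕ) : ℤ)))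

/-- THEOREM B shape: DESC-P restricted to quadruples whose odd-form members have positive rank (automatic under finiteness of
`Ш(W^{(dᵢ)})[2^∞]`, and unconditional when `L'(W^{(dᵢ)}, 1) ≠ 0` by Gross–Zagier–Kolyvagin). = REF1-AUDIT §35's repair DESC-P′ of the
landed `OddBranchEggCasselsTateParityLawAtTwo` (THEOREM-GRADE per REF1 §35; loses no census row). REF2-PLACEMENT v16 §19 / §24: mechanism IN PRINT
(Morgan 2023 §1.2: unique `Sel⁴`-lift + odd `rk₂` + Ш finite ⇒ rational point), the REAL-COMPONENT reading NOT in print ⇒ new-combination,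
«beyond-print theorem (small) by in-print assembly», nearest print Morgan 2023 Prop 19 / §1.2. REF1-AUDIT §41: THEOREM B glue PROVED; B⁰ / U′ theorem-grade modulo the model ↔ `PrimeTwist` dictionary (Mazur–Rubin 2007 §3), to be typed by -desc as a support row `TwistModelDictionaryAtTwo` (REF1 recommendation, non-blocking); rank hypothesis load-bearing as typed.
[cite: Morgan2023KummerGeneric, §1.2, Prop 19] [cite: MorganSmith2021CTP, Thm 1.3] [cite: Kramer1981, Prop. 6] -/
def OddBranchEggCasselsTateParityLawOfPosRankAtTwo : Prop :=
  ∀ (W : WeierstrassCurve ℚ) [W.IsElliptic] [W.IsGloballyMinimal], OnOddBranchAtTwo W →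
    ∀ d₁ d₂ d₃ d₄ : ℤ, DescAdmissible W d₁ → DescAdmissible W d₂ → DescAdmissible W d₃ → DescAdmissible W d₄ →
      (∀ d ∈ [d₁, d₂, d₃, d₄], ¬ ShaTwoInTwiceShaFour (W.quadraticTwist (d : ℚ)) → 0 < (W.quadraticTwist (d : ℚ)).mordellWeilRank) →
      IsSquare (d₁ * d₂ * d₃ * d₄) →
        ((EggCasselsTateBitAtTwo W d₁ ↔ EggCasselsTateBitAtTwo W d₂) ↔
          (EggCasselsTateBitAtTwo W d₃ ↔ EggCasselsTateBitAtTwo W d₄))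

/-- Proved glue (THEOREM B from its parts): DESC-A∞ + bridge + existence of characters ⇒ DESC-P for positive-rank quadruples. -/
theorem eggParityLawOfPosRank_of_radicalLaw (hA : OddBranchCasselsTateRadicalRealParityLawAtTwo)
    (hB : OddBranchEggBitEqRadicalBitAtTwo) (hχ : QuadraticCharacterExists) :
    OddBranchEggCasselsTateParityLawOfPosRankAtTwo := by
  intro W _ _ hW d₁ d₂ d₃ d₄ h₁ h₂ h₃ h₄ hrk hsq
  obtain ⟨χ₁, c₁⟩ := hχ d₁
  obtain ⟨χ₂, c₂⟩ := hχ d₂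
  obtain ⟨χ₃, c₃⟩ := hχ d₃
  obtain ⟨χ₄, c₄⟩ := hχ d₄
  have e₁ := hB W hW d₁ χ₁ h₁ c₁ (hrk d₁ (by simp))
  have e₂ := hB W hW d₂ χ₂ h₂ c₂ (hrk d₂ (by simp))
  have e₃ := hB W hW d₃ χ₃ h₃ c₃ (hrk d₃ (by simp))
  have e₄ := hB W hW d₄ χ₄ h₄ c₄ (hrk d₄ (by simp))
  rw [e₁, e₂, e₃, e₄]
  exact hA W hW d₁ d₂ d₃ d₄ χ₁ χ₂ χ₃ χ₄ h₁ h₂ h₃ h₄ c₁ c₂ c₃ c₄ hsq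

end Summit.BirchSwinnertonDyer.Rank1Residual.F1Sign2
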